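import Literature.AlgebraicGeometry.Resolution.OstrowskiRamification
import Literature.AlgebraicGeometry.Resolution.HenselRootsAmbient
import Literature.AlgebraicGeometry.Resolution.HenselizationHenselian
import Literature.AlgebraicGeometry.Resolution.RankOneDensity
import HarnessLib

/-!
# `K(z)^h = K(f(z))^h` for a polynomial with a unique dominant coefficient of index prime to `p` (Kuhlmann 2019, Lemma 4.7)

Topic: `Literature/AlgebraicGeometry/Resolution` (valued function fields). A PROVED step of
Prop. 4.8/4.9 (the degree-`p` step `(hstep)` to which `Kuhlmann2019Prop52Reduction.lean`
reduces the named fact `Kuhlmann2019_Prop52_sepClosed`) of F.-V. Kuhlmann, *Elimination of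
ramification II: Henselian rationality*, Israel J. Math. 234 (2019) = arXiv:1701.05508, §4.2
(p. 10):

> We will also need the following result which is a consequence of [23, Theorem 9.1 in
> conjunction with Corollary 7.7]. A direct proof can also be found in [7].
> **Lemma 4.7.** Assume that the extension `(K(z)|K, v)` is immediate with `vz = 0`, and that
> the approximation type of `z` over `K` is transcendental. Take a polynomial
> `f(X) = a_n X^n + … + a_0 ∈ K[X]` for which there is an index `i₀ ∈ {1,…,n}` with `p ∤ i₀`
> such that `a_{i₀}` is the unique coefficient of least value among `a_1,…,a_n`. Then
> [`K(z)^h = K(f(z))^h`].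

(the displayed conclusion is lost in the held text; it is the one used in the proofs of
Props. 4.8 and 4.9, p. 11: "From Lemma 4.7 we infer that `K(z)^h = K(g(z))^h`"; [23] =
Kuhlmann–Vlahu, Math. Z. 276 (2014); [7] = Yu. L. Ershov, *On Henselian rationality of
extensions*, Dokl. Math. 78 (2008).) This file gives a DIRECT PROOF by the uniqueness of Hensel
roots, which needs of the printed hypotheses only `vz = 0`, `zv ∈ Kv` (a consequence of the
immediateness of `K(z)|K`) and the coefficient condition — the transcendental approximation
type is not used. With `y = f(z)` and `G = a_{i₀}⁻¹(f − y) ∈ O_{K(y)}[X]`: `G(z) = 0`, the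
reduction of `G` is `X^{i₀} − \bar z^{i₀}` up to terms that vanish (all other coefficients of
positive index have smaller value), so `v(G'(z)) = v(i₀ z^{i₀−1}) = 0`; every `K(y)^h`-conjugate
`w` of `z` is a root of `G` with `v(w − z) > 0` (embeddings over the henselian `K(y)^h` preserve
the valuation, and `z ≡ c ∈ K` modulo the maximal ideal), hence `w = z` by the uniqueness of
Hensel roots; so the minimal polynomial of `z` over `K(y)^h` has the single root `z`, is
separable (`G'(z) ≠ 0`), and has degree `1`: `z ∈ K(y)^h`.

## Content (everything PROVED; no definition, no named fact)

* `valuation_natCast_eq_one_of_residue_ne_zero` — `v(n) = 1` when `n ≠ 0` in the residue field.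
* `mem_of_forall_aroots_eq` — over any subfield `L ≤ Ω` (`Ω` algebraically closed): if `z` is
  integral over `L`, `(minpoly_L z)'(z) ≠ 0`, and every root in `Ω` of `minpoly_L z` equals `z`,
  then `z ∈ L`.
* `mem_henselization_of_root_of_valuation_derivative_eq_one` — **the Hensel-uniqueness
  principle**: for `L ≤ Ω`, a polynomial `G` over `O_L = V ∩ L` with a root `z ∈ V`,
  `v(G'(z)) = 1`, and `z ≡ c` modulo `𝔪_V` for some `c ∈ L`, we have `z ∈ L^h`.
* `mem_henselization_closure_eval` — **Lemma 4.7**: `z ∈ K(f(z))^h`;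
  `henselization_closure_eval_eq` — `K(f(z))^h = K(z)^h`.

## Sources

* [K19] F.-V. Kuhlmann, Israel J. Math. 234 (2019) = arXiv:1701.05508: Lemma 4.7 (p. 10),
  proofs of Props. 4.8, 4.9 (p. 11). [Kuhlmann2019]
* [K10] F.-V. Kuhlmann, Trans. AMS 362 (2010) = arXiv:1003.5678: §1.1 (henselian fields,
  uniqueness of the extension), Lemma 2.2. [Kuhlmann2010]

## Rendering notes

As in `Kuhlmann2019Lemma41.lean`: `(Ω, V)` one algebraically closed valued field, `K ≤ Ω`,
`K(w) = Subfield.closure (K ∪ {w})`, `K(w)^h = henselization V K(w)` (`Henselization.lean`),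
polynomials over `K` = polynomials over `Ω` with coefficients in `K`, values multiplicative
(`vz = 0` ↦ `V.valuation z = 1`; "least value among `a_1,…,a_n`" ↦ largest `V.valuation`);
`p ∤ i₀` ↦ `(i₀ : ResidueField V) ≠ 0` (no assumption on the characteristic is needed).
-/

noncomputable section

namespace Literature.AlgebraicGeometry.Resolution

universe u

open Polynomial IsLocalRing IntermediateField

variable {Ω : Type u} [Field Ω] (V : ValuationSubring Ω)

/-! ### Bookkeeping -/

/-- `v(n) = 1` for a natural number `n` which is non-zero in the residue field of `V`.
[folklore] -/
theorem valuation_natCast_eq_one_of_residue_ne_zero {n : ℕ} (hn : (n : ResidueField V) ≠ 0) :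
    V.valuation (n : Ω) = 1 := by
  have hle : V.valuation ((n : V) : Ω) ≤ 1 := V.valuation_le_one _
  have hcoe : ((n : V) : Ω) = (n : Ω) := by simp
  rw [hcoe] at hle
  refine le_antisymm hle (not_lt.mp fun hlt => hn ?_)
  have hmem : (n : V) ∈ IsLocalRing.maximalIdeal V :=
    (ValuationSubring.valuation_lt_one_iff V (n : V)).mpr (by rw [hcoe]; exact hlt)
  have h0 : residue V (n : V) = 0 := (residue_eq_zero_iff _).mpr hmem
  rwa [map_natCast] at h0

section Descent

variable [IsAlgClosed Ω]

omit V in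
/-- **An element all of whose conjugates coincide with it lies in the base field**: for a
subfield `L ≤ Ω` of the algebraically closed `Ω` and `z ∈ Ω` integral over `L` with
`(minpoly_L z)'(z) ≠ 0` (so that the minimal polynomial is separable), if every root of
`minpoly_L z` in `Ω` equals `z`, then `z ∈ L`. [folklore] -/
theorem mem_of_forall_aroots_eq {L : Subfield Ω} {z : Ω} (hint : IsIntegral L z)
    (hder : aeval z (derivative (minpoly L z)) ≠ 0)
    (hroots : ∀ w ∈ (minpoly L z).aroots Ω, w = z) : z ∈ L := by
  classical
  set μ : Polynomial L := minpoly L z with hμ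
  have hirr : Irreducible μ := minpoly.irreducible hint
  have hder0 : derivative μ ≠ 0 := fun h0 => hder (by rw [h0, map_zero])
  have hsep : μ.Separable := (separable_iff_derivative_ne_zero hirr).mpr hder0
  have hsplit : Splits (μ.map (algebraMap L Ω)) := IsAlgClosed.splits _
  -- the roots of `μ` in `Ω`: the nodup multiset `replicate n z`, so `n ≤ 1`
  have hnodup : (μ.aroots Ω).Nodup := nodup_roots hsep.map
  set n : ℕ := Multiset.card (μ.aroots Ω) with hn
  have hrep : μ.aroots Ω = Multiset.replicate n z := by
    rw [hn]
    exact Multiset.eq_replicate_card.mpr hroots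
  have hn1 : n ≤ 1 := by
    have hc := Multiset.nodup_iff_count_le_one.mp hnodup z
    rwa [hrep, Multiset.count_replicate_self] at hc
  have hdeg : μ.natDegree = n := by
    rw [← natDegree_map (algebraMap L Ω), hsplit.natDegree_eq_card_roots]
  have hpos : 0 < μ.natDegree := minpoly.natDegree_pos hint
  have h1 : (minpoly L z).natDegree = 1 := by
    change μ.natDegree = 1
    omega
  obtain ⟨c, hc⟩ := minpoly.natDegree_eq_one_iff.mp h1
  rw [← hc]
  exact c.2

/-- **The Hensel-uniqueness principle for the henselization.** Let `L ≤ Ω` be a subfield, `G`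
a polynomial over `O_L = V ∩ L`, `z ∈ V` a root of `G` with `v(G'(z)) = 1`, and assume
`z ≡ c` modulo `𝔪_V` for some `c ∈ L`. Then `z ∈ L^h = henselization V L`. PROOF: `z` is
algebraic over `L^h`; every root `w ∈ Ω` of its minimal polynomial over `L^h` is the image of
`z` under an `L^h`-embedding `L^h(z) → Ω`, which preserves the valuation (`L^h` is henselian:
`Kuhlmann2010HenselizationIsHenselian_holds`, `IsHenselianField.valuation_algHom_apply`), so
`G(w) = 0` and `v(w − c) = v(z − c) < 1`; by the uniqueness of Hensel roots
(`eq_of_roots_of_valuation_sub_lt_one`) `w = z`; and `z ∈ L^h` by `mem_of_forall_aroots_eq`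
(`(minpoly)'(z) ≠ 0` because `G'(z) ≠ 0`). [cite: Kuhlmann2010, Section 1.1] -/
theorem mem_henselization_of_root_of_valuation_derivative_eq_one {L : Subfield Ω}
    {G : Polynomial Ω} (hG : ∀ k, G.coeff k ∈ V ∧ G.coeff k ∈ L) {z : Ω} (hzV : z ∈ V)
    (hGz : G.eval z = 0) (hder : V.valuation ((derivative G).eval z) = 1)
    {c : Ω} (hcL : c ∈ L) (hzc : V.valuation (z - c) < 1) :
    z ∈ henselization V L := by
  classical
  set Lh : Subfield Ω := henselization V L with hLhdef
  have hLLh : L ≤ Lh := le_henselization V L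
  have hLh : IsHenselianField Lh (V.comap (algebraMap Lh Ω)) :=
    Kuhlmann2010HenselizationIsHenselian_holds Ω V L
  -- `G` lifted to `Lh[X]`; `z` is algebraic over `Lh`
  have hG0 : G ≠ 0 := fun h0 => by
    rw [h0, derivative_zero, eval_zero, map_zero] at hder
    exact zero_ne_one hder
  obtain ⟨Gl, hGL⟩ : ∃ Gl : Polynomial Lh, Gl.map (algebraMap Lh Ω) = G :=
    (Polynomial.mem_lifts G).mp ((Polynomial.lifts_iff_coeff_lifts G).mpr
      fun k => ⟨⟨G.coeff k, hLLh (hG k).2⟩, rfl⟩)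
  have hGL0 : Gl ≠ 0 := fun h0 => hG0 (by rw [← hGL, h0, Polynomial.map_zero])
  have hGLz : aeval z Gl = 0 := by rw [aeval_def, ← eval_map, hGL, hGz]
  have halg : IsAlgebraic Lh z := ⟨Gl, hGL0, hGLz⟩
  have hint : IsIntegral Lh z := halg.isIntegral
  refine mem_of_forall_aroots_eq hint ?_ ?_
  · -- `(minpoly)'(z) ≠ 0`
    obtain ⟨q, hq⟩ := minpoly.dvd Lh z hGLz
    intro h0
    have h1 : (derivative G).eval z = 0 := by
      rw [← hGL, derivative_map, eval_map, ← aeval_def, hq, derivative_mul, map_add, map_mul,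
        map_mul, h0, minpoly.aeval, zero_mul, zero_mul, add_zero]
    rw [h1, map_zero] at hder
    exact zero_ne_one hder
  · intro w hw
    -- the `Lh`-embedding `Lh(z) → Ω` with `z ↦ w`
    set φ : Lh⟮z⟯ →ₐ[Lh] Ω := (algHomAdjoinIntegralEquiv Lh hint).symm ⟨w, hw⟩ with hφdef
    have hφ : φ (AdjoinSimple.gen Lh z) = w :=
      algHomAdjoinIntegralEquiv_symm_apply_gen Lh hint ⟨w, hw⟩
    haveI : Algebra.IsAlgebraic Lh Lh⟮z⟯ := IntermediateField.isAlgebraic_adjoin_simple hint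
    have hgen : algebraMap Lh⟮z⟯ Ω (AdjoinSimple.gen Lh z) = z := AdjoinSimple.algebraMap_gen Lh z
    -- `G(w) = 0`
    have hGw : G.eval w = 0 := by
      have h1 : aeval (AdjoinSimple.gen Lh z) Gl = 0 := by
        apply (algebraMap Lh⟮z⟯ Ω).injective
        rw [map_zero, ← Polynomial.aeval_algebraMap_apply, hgen, hGLz]
      have h2 : aeval w Gl = 0 := by
        rw [← hφ, Polynomial.aeval_algHom_apply, h1, map_zero]
      rw [← hGL, eval_map, ← aeval_def, h2]
    -- `v(w - c) = v(z - c) < 1`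
    set cL : Lh := ⟨c, hLLh hcL⟩ with hcLdef
    have hwc : w - c = φ (AdjoinSimple.gen Lh z - algebraMap Lh Lh⟮z⟯ cL) := by
      rw [map_sub, hφ, AlgHom.commutes]
      rfl
    have hvwc : V.valuation (w - c) < 1 := by
      rw [hwc, IsHenselianField.valuation_algHom_apply V hLh φ, map_sub, hgen]
      exact hzc
    have hcV : c ∈ V := by
      have hc' : c = z + -(z - c) := by ring
      rw [hc']
      refine add_mem hzV (neg_mem ((V.valuation_le_one_iff _).mp hzc.le))
    have hwV : w ∈ V := by
      have hw' : w = (w - c) + c := by ring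
      rw [hw']
      exact add_mem ((V.valuation_le_one_iff _).mp hvwc.le) hcV
    have hwz : V.valuation (w - z) < 1 := by
      have hsplit' : w - z = (w - c) + -(z - c) := by ring
      rw [hsplit']
      refine lt_of_le_of_lt (V.valuation.map_add _ _) (max_lt hvwc ?_)
      rw [Valuation.map_neg]
      exact hzc
    exact (eq_of_roots_of_valuation_sub_lt_one V (fun k => (hG k).1) hzV hwV hGz hGw hwz hder).symm

/-! ### Lemma 4.7 -/

/-- **Kuhlmann 2019, Lemma 4.7: `z ∈ K(f(z))^h`.** Let `K ≤ Ω`, `z ∈ Ω` with `v(z) = 1`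
("`vz = 0`") and `v(z − c) < 1` for some `c ∈ K` ("`zv ∈ Kv`", e.g. `K(z)|K` immediate), and
let `f` be a polynomial over `K` with a coefficient `a_{i₀} ≠ 0`, `0 < i₀`, `i₀ ≠ 0` in the
residue field ("`p ∤ i₀`"), such that `v(aᵢ) < v(a_{i₀})` for all other `i > 0` ("`a_{i₀}` is
the unique coefficient of least value among `a_1,…,a_n`"). Then `z ∈ K(f(z))^h`. PROOF: with
`y = f(z)`, the polynomial `G = a_{i₀}⁻¹(f − y)` has coefficients in `V ∩ K(y)`, `G(z) = 0`
and `v(G'(z)) = v(i₀ z^{i₀−1}) = 1` (the other terms of `a_{i₀}⁻¹ f'(z)` have value `< 1`);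
conclude by `mem_henselization_of_root_of_valuation_derivative_eq_one`.
[cite: Kuhlmann2019, Lemma 4.7] -/
theorem mem_henselization_closure_eval {K : Subfield Ω} {z : Ω} (hz1 : V.valuation z = 1)
    (hzres : ∃ c ∈ K, V.valuation (z - c) < 1)
    {f : Polynomial Ω} (hf : ∀ k, f.coeff k ∈ K) {i₀ : ℕ} (hi₀ : 0 < i₀)
    (hpi₀ : (i₀ : ResidueField V) ≠ 0) (ha : f.coeff i₀ ≠ 0)
    (hdom : ∀ i, 0 < i → i ≠ i₀ → V.valuation (f.coeff i) < V.valuation (f.coeff i₀)) :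
    z ∈ henselization V (Subfield.closure ((K : Set Ω) ∪ {f.eval z})) := by
  classical
  obtain ⟨c, hcK, hzc⟩ := hzres
  set a : Ω := f.coeff i₀ with hadef
  set y : Ω := f.eval z with hydef
  set Ky : Subfield Ω := Subfield.closure ((K : Set Ω) ∪ {y}) with hKydef
  have hKKy : K ≤ Ky := fun b hb => Subfield.subset_closure (Or.inl hb)
  have hyKy : y ∈ Ky := Subfield.subset_closure (Or.inr rfl)
  have hzV : z ∈ V := (V.valuation_le_one_iff z).mp hz1.le
  have hva : V.valuation a ≠ 0 := (_root_.map_ne_zero _).mpr ha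
  have hva' : 0 < V.valuation a := zero_lt_iff.mpr hva
  set N : ℕ := f.natDegree with hNdef
  have hi₀N : i₀ ≤ N := le_natDegree_of_ne_zero ha
  -- values of the coefficients: `v(aᵢ zⁱ) ≤ v(a)` for `i > 0`
  have hcoefle : ∀ i, 0 < i → V.valuation (f.coeff i) ≤ V.valuation a := by
    intro i hi
    by_cases hii : i = i₀
    · rw [hii]
    · exact (hdom i hi hii).le
  have hzpow : ∀ k : ℕ, V.valuation (z ^ k) = 1 := fun k => by rw [map_pow, hz1, one_pow]
  -- the polynomial `G = a⁻¹ (f − y)`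
  set G : Polynomial Ω := C a⁻¹ * (f - C y) with hGdef
  have hGcoeff : ∀ k, G.coeff k = a⁻¹ * (f.coeff k - if k = 0 then y else 0) := by
    intro k
    rw [hGdef, coeff_C_mul, coeff_sub, coeff_C]
  have hGz : G.eval z = 0 := by
    rw [hGdef, eval_mul, eval_C, eval_sub, eval_C, ← hydef, sub_self, mul_zero]
  -- `a₀ − y = −∑_{k<N} a_{k+1} z^{k+1}` has value `≤ v(a)`
  have hy : y = ∑ k ∈ Finset.range N, f.coeff (k + 1) * z ^ (k + 1) + f.coeff 0 := by
    rw [hydef, eval_eq_sum_range, Finset.sum_range_succ', pow_zero, mul_one]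
  have hv0 : V.valuation (f.coeff 0 - y) ≤ V.valuation a := by
    have h1 : f.coeff 0 - y = -∑ k ∈ Finset.range N, f.coeff (k + 1) * z ^ (k + 1) := by
      rw [hy]; ring
    rw [h1, Valuation.map_neg]
    refine V.valuation.map_sum_le fun k _ => ?_
    rw [map_mul, hzpow, mul_one]
    exact hcoefle (k + 1) (Nat.succ_pos k)
  -- coefficients of `G` lie in `V ∩ K(y)`
  have hGcoef : ∀ k, G.coeff k ∈ V ∧ G.coeff k ∈ Ky := by
    intro k
    rw [hGcoeff k]
    refine ⟨(V.valuation_le_one_iff _).mp ?_, ?_⟩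
    · rw [map_mul, map_inv₀]
      rw [inv_mul_le_iff₀ hva', mul_one]
      by_cases hk : k = 0
      · rw [if_pos hk, hk]
        exact hv0
      · rw [if_neg hk, sub_zero]
        exact hcoefle k (Nat.pos_of_ne_zero hk)
    · refine mul_mem (Ky.inv_mem (hKKy (hf i₀))) (sub_mem (hKKy (hf k)) ?_)
      by_cases hk : k = 0
      · rw [if_pos hk]; exact hyKy
      · rw [if_neg hk]; exact Ky.zero_mem
  -- `v(G'(z)) = 1`
  have hder : V.valuation ((derivative G).eval z) = 1 := by
    have hderf : (derivative f).eval z =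
        ∑ k ∈ Finset.range (N + 1), f.coeff (k + 1) * (k + 1 : ℕ) * z ^ k := by
      rw [eval_eq_sum_range' (n := N + 1) (lt_of_le_of_lt (natDegree_derivative_le f) (by omega)) z]
      refine Finset.sum_congr rfl fun k _ => ?_
      rw [coeff_derivative]
      push_cast
      ring
    have hderG : (derivative G).eval z =
        ∑ k ∈ Finset.range (N + 1), a⁻¹ * (f.coeff (k + 1) * (k + 1 : ℕ) * z ^ k) := by
      rw [hGdef, derivative_C_mul, derivative_sub, derivative_C, sub_zero, eval_mul, eval_C,
        hderf, Finset.mul_sum]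
    rw [hderG]
    have hmem : i₀ - 1 ∈ Finset.range (N + 1) := Finset.mem_range.mpr (by omega)
    rw [← Finset.add_sum_erase _ _ hmem]
    -- the dominant term `i₀ z^{i₀−1}`
    have hi₀' : i₀ - 1 + 1 = i₀ := Nat.sub_add_cancel hi₀
    have hmain : V.valuation (a⁻¹ * (f.coeff (i₀ - 1 + 1) * ((i₀ - 1 + 1 : ℕ) : Ω) *
        z ^ (i₀ - 1))) = 1 := by
      rw [hi₀', ← hadef, map_mul, map_mul, map_mul, map_inv₀, hzpow, mul_one,
        valuation_natCast_eq_one_of_residue_ne_zero V hpi₀, mul_one, inv_mul_cancel₀ hva]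
    have hrest : V.valuation (∑ k ∈ (Finset.range (N + 1)).erase (i₀ - 1),
        a⁻¹ * (f.coeff (k + 1) * ((k + 1 : ℕ) : Ω) * z ^ k)) < 1 := by
      refine V.valuation.map_sum_lt one_ne_zero fun k hk => ?_
      have hki : k + 1 ≠ i₀ := by
        have : k ≠ i₀ - 1 := (Finset.mem_erase.mp hk).1
        omega
      have hnat : V.valuation (((k + 1 : ℕ) : Ω)) ≤ 1 := by
        have := V.valuation_le_one ((k + 1 : ℕ) : V)
        push_cast at this ⊢
        exact this
      rw [map_mul, map_mul, map_mul, map_inv₀, hzpow, mul_one]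
      calc (V.valuation a)⁻¹ * (V.valuation (f.coeff (k + 1)) * V.valuation ((k + 1 : ℕ) : Ω))
          ≤ (V.valuation a)⁻¹ * (V.valuation (f.coeff (k + 1)) * 1) := by gcongr
        _ < (V.valuation a)⁻¹ * (V.valuation a * 1) := by
            rw [mul_one, mul_one]
            exact mul_lt_mul_of_pos_left (hdom (k + 1) (Nat.succ_pos k) hki)
              (zero_lt_iff.mpr (inv_ne_zero hva))
        _ = 1 := by rw [mul_one, inv_mul_cancel₀ hva]
    rw [V.valuation.map_add_eq_of_lt_left (lt_of_lt_of_eq hrest hmain.symm)]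
    exact hmain
  exact mem_henselization_of_root_of_valuation_derivative_eq_one V hGcoef hzV hGz hder
    (hKKy hcK) hzc

/-- **Kuhlmann 2019, Lemma 4.7: `K(f(z))^h = K(z)^h`** under the hypotheses of
`mem_henselization_closure_eval` (`K(f(z)) ⊆ K(z)` gives `⊆`; `z ∈ K(f(z))^h` and the minimality
of the henselization, `henselization_le_of_isHenselianField`, give `⊇`).
[cite: Kuhlmann2019, Lemma 4.7] -/
theorem henselization_closure_eval_eq {K : Subfield Ω} {z : Ω} (hz1 : V.valuation z = 1)
    (hzres : ∃ c ∈ K, V.valuation (z - c) < 1)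
    {f : Polynomial Ω} (hf : ∀ k, f.coeff k ∈ K) {i₀ : ℕ} (hi₀ : 0 < i₀)
    (hpi₀ : (i₀ : ResidueField V) ≠ 0) (ha : f.coeff i₀ ≠ 0)
    (hdom : ∀ i, 0 < i → i ≠ i₀ → V.valuation (f.coeff i) < V.valuation (f.coeff i₀)) :
    henselization V (Subfield.closure ((K : Set Ω) ∪ {f.eval z})) =
      henselization V (Subfield.closure ((K : Set Ω) ∪ {z})) := by
  set Ky : Subfield Ω := Subfield.closure ((K : Set Ω) ∪ {f.eval z}) with hKydef
  set Kz : Subfield Ω := Subfield.closure ((K : Set Ω) ∪ {z}) with hKzdef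
  have hKKz : K ≤ Kz := fun b hb => Subfield.subset_closure (Or.inl hb)
  have hzKz : z ∈ Kz := Subfield.subset_closure (Or.inr rfl)
  have hKKy : K ≤ Ky := fun b hb => Subfield.subset_closure (Or.inl hb)
  apply le_antisymm
  · -- `K(f(z)) ≤ K(z)`
    refine henselization_mono V Kuhlmann2010HenselizationIsHenselian_holds
      (Subfield.closure_le.mpr (Set.union_subset hKKz (Set.singleton_subset_iff.mpr ?_)))
    exact eval_mem_subfield_of_coeff_mem (fun k => hKKz (hf k)) hzKz
  · -- `K(z) ≤ K(f(z))^h`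
    refine henselization_le_of_isHenselianField V Kz
      (Subfield.closure_le.mpr (Set.union_subset (hKKy.trans (le_henselization V Ky))
        (Set.singleton_subset_iff.mpr ?_)))
      (Kuhlmann2010HenselizationIsHenselian_holds Ω V Ky)
    exact mem_henselization_closure_eval V hz1 hzres hf hi₀ hpi₀ ha hdom

end Descent

end Literature.AlgebraicGeometry.Resolution

end
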